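import Literature.AlgebraicGeometry.Morphisms.DevissageClass
import Literature.AlgebraicGeometry.Modules.VectorBundleFiniteLocallyFree
import Literature.AlgebraicGeometry.Modules.LocalFrames
import HarnessLib

/-!
# Vector bundles are coherent in the affine-local sense `Coh`

The finiteness and formal-functions theorems of `Literature/AlgebraicGeometry/Morphisms/`
(`Devissage*`, `CechH1*`, `FormalFunctionsModule*`) consume coherence in the affine-local form
`Coh M` of `Morphisms/DevissageClass` (`IsAffineLocalizing`: numerators and torsion on the principal
opens of every affine open, EGA I 1.4.1 / Hartshorne II Lemma 5.3; `IsAffineFiniteType`: `Γ(V, M)`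
finitely generated over `Γ(V, 𝒪_X)` for every affine `V`, Hartshorne II Prop. 5.4). This file proves
that a VECTOR BUNDLE (`Literature.AlgebraicGeometry.Motives.IsVectorBundle` = Mathlib locally free +
finite type; equivalently finite locally free, `Modules/VectorBundleFiniteLocallyFree`) is coherent in
this sense (Hartshorne II Prop. 5.4 with Prop. 5.5: locally free of finite rank ⇒ coherent):

* `exists_fg_pow_smul_mem` — for an affine-localizing `M` trivialised with a finite basis over an open
  containing the basic open `D(g)` of an affine `V`, some finitely generated submodule of `Γ(V, M)`
  contains a `g`-power multiple of every section over `V` (numerators of the restricted basis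
  sections; basis expansion over `D(g)`, tree `eq_sum_coord_smul`; torsion);
* `isAffineFiniteType_of_isVectorBundle` — hence `Γ(V, M)` is finitely generated for affine `V`
  (cover `V` by finitely many such `D(g)` and descend along the finite principal cover, Mathlib
  `Submodule.mem_of_span_eq_top_of_smul_pow_mem`);
* `coh_of_isVectorBundle` — **a vector bundle is `Coh`** (quasi-coherent ⇒ affine-localizing,
  `IsAffineLocalizing.of_isQuasicoherent`).

Provenance: the proofs are PORTED into `Literature` from the summit-side work file
`Summits/HodgeConjecture/HodgeConjecture/Theorems/
PadicSemiregularLiftFormalVectorBundlesAlgebraizeModuleBockstein.lean` (2026-08-16), with the finite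
local freeness now taken from the tree's `isFiniteLocallyFree_of_isVectorBundle`; known mathematics
belongs here (theorems only; no definition is introduced).

## References

* R. Hartshorne, *Algebraic Geometry*, GTM 52 (1977): II Lemma 5.3, Prop. 5.4, Prop. 5.5
  (pp. 112–113). [Hartshorne1977]
* The Stacks project, Tag 01C6 (finite locally free modules). [StacksProject]
-/

noncomputable section

open CategoryTheory AlgebraicGeometry Limits TopologicalSpace Opposite
open Literature.AlgebraicGeometry.Modules Literature.AlgebraicGeometry.Motives

universe u

namespace Literature.AlgebraicGeometry.Morphisms

variable {X : Scheme.{u}}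

/-- For an affine-localizing module `M` trivialised, with a finite basis, over an open `U` containing
the basic open `D(g)` of an affine open `V`, there is a finitely generated submodule of `Γ(V, M)`
containing a `g`-power multiple of every section of `M` over `V` (numerators of the restricted basis
sections; the basis expansion over `D(g)`; torsion). [cite: Hartshorne1977, II Lemma 5.3 and Prop. 5.4 (pp. 112–113)] -/
theorem exists_fg_pow_smul_mem {M : X.Modules} (hM : IsAffineLocalizing M)
    {V : X.Opens} (hV : IsAffineOpen V) (g : Γ(X, V)) {U : X.Opens} (hgU : X.basicOpen g ≤ U)
    {I : Type u} [Fintype I] (e : SheafOfModules.free I ≅ M.over U) :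
    ∃ N : Submodule Γ(X, V) Γ(M, V), N.FG ∧ ∀ m : Γ(M, V), ∃ n : ℕ, g ^ n • m ∈ N := by
  classical
  have hWV : X.basicOpen g ≤ V := X.basicOpen_le g
  -- the restricted basis sections and their numerators
  let b : I → Γ(M, X.basicOpen g) := fun i => M.presheaf.map (homOfLE hgU).op (basisSection e i)
  have hnum : ∀ i, ∃ (n : ℕ) (x : Γ(M, V)), M.presheaf.map (homOfLE hWV).op x =
      X.presheaf.map (homOfLE hWV).op g ^ n • b i := fun i => hM.numerator hV g rfl (b i)
  choose n x hx using hnum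
  let N : Submodule Γ(X, V) Γ(M, V) := Submodule.span Γ(X, V) (Set.range x)
  refine ⟨N, Submodule.fg_span (Set.finite_range x), fun m => ?_⟩
  -- every section over `D(g)` becomes, after a power of `g`, the restriction of an element of `N`
  have key : ∀ s : Γ(M, X.basicOpen g), ∃ (k : ℕ) (y : Γ(M, V)), y ∈ N ∧
      M.presheaf.map (homOfLE hWV).op y = X.presheaf.map (homOfLE hWV).op g ^ k • s := by
    intro s
    have hs : s ∈ Submodule.span Γ(X, X.basicOpen g) (Set.range b) := by
      rw [eq_sum_coord_smul e (homOfLE hgU) s]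
      exact Submodule.sum_mem _ fun i _ => Submodule.smul_mem _ _ (Submodule.subset_span ⟨i, rfl⟩)
    induction hs using Submodule.span_induction with
    | mem s hs =>
      obtain ⟨i, rfl⟩ := hs
      exact ⟨n i, x i, Submodule.subset_span ⟨i, rfl⟩, hx i⟩
    | zero => exact ⟨0, 0, N.zero_mem, by rw [map_zero, smul_zero]⟩
    | add s s' _ _ ih ih' =>
      obtain ⟨k, y, hy, hys⟩ := ih
      obtain ⟨k', y', hy', hys'⟩ := ih'
      refine ⟨k + k', g ^ k' • y + g ^ k • y', N.add_mem (N.smul_mem _ hy) (N.smul_mem _ hy'), ?_⟩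
      rw [map_add, Scheme.Modules.map_smul, Scheme.Modules.map_smul, hys, hys', map_pow, map_pow,
        smul_smul, smul_smul, ← pow_add, ← pow_add, add_comm k' k, smul_add]
    | smul c s _ ih =>
      obtain ⟨k, y, hy, hys⟩ := ih
      haveI := hV.isLocalization_basicOpen g
      obtain ⟨⟨a, ⟨_, k', rfl⟩⟩, hac⟩ := IsLocalization.surj (Submonoid.powers g) c
      refine ⟨k' + k, a • y, N.smul_mem a hy, ?_⟩
      change c * X.presheaf.map (homOfLE hWV).op (g ^ k') = X.presheaf.map (homOfLE hWV).op a at hac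
      rw [Scheme.Modules.map_smul, hys, ← hac, map_pow, smul_smul, smul_smul, pow_add]
      ring_nf
  obtain ⟨k, y, hy, hyk⟩ := key (M.presheaf.map (homOfLE hWV).op m)
  have h0 : M.presheaf.map (homOfLE hWV).op (y - g ^ k • m) = 0 := by
    rw [map_sub, Scheme.Modules.map_smul, map_pow, hyk, sub_self]
  obtain ⟨k', hk'⟩ := hM.torsion hV g (y - g ^ k • m) hWV le_rfl h0
  refine ⟨k' + k, ?_⟩
  rw [smul_sub, sub_eq_zero] at hk'
  rw [pow_add, mul_smul, ← hk']
  exact N.smul_mem _ hy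

/-- **A vector bundle is of affine-finite type**: `Γ(V, M)` is a finitely generated `Γ(V, 𝒪_X)`-module
for every affine open `V` (Hartshorne II Prop. 5.4: cover `V` by finitely many basic opens `D(g)`
inside trivialising opens of the finite locally free `M`, `exists_fg_pow_smul_mem` on each, and
descend finite generation along the finite principal cover, Mathlib
`Submodule.mem_of_span_eq_top_of_smul_pow_mem`). [cite: Hartshorne1977, II Prop. 5.4 (p. 113)] -/
theorem isAffineFiniteType_of_isVectorBundle {M : X.Modules} (hM : IsVectorBundle M)
    (hloc : IsAffineLocalizing M) : IsAffineFiniteType M := by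
  classical
  have hfree : IsFiniteLocallyFree M := isFiniteLocallyFree_of_isVectorBundle hM
  intro V hV
  -- the functions `g` on `V` with a fixed f.g. submodule containing a `g`-power multiple of everything
  let T : Set Γ(X, V) :=
    {g | ∃ N : Submodule Γ(X, V) Γ(M, V), N.FG ∧ ∀ m : Γ(M, V), ∃ n : ℕ, g ^ n • m ∈ N}
  have hT : Ideal.span T = ⊤ := by
    rw [← hV.self_le_iSup_basicOpen_iff]
    intro x hxV
    obtain ⟨U, hxU, I, hI, ⟨e⟩⟩ := hfree x
    haveI := Fintype.ofFinite I
    obtain ⟨g, hgU, hxg⟩ := hV.exists_basicOpen_le ⟨x, hxU⟩ hxV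
    have hgT : g ∈ T := exists_fg_pow_smul_mem hloc hV g hgU e
    exact Opens.mem_iSup.mpr ⟨⟨g, hgT⟩, hxg⟩
  obtain ⟨T', hT'T, hT'⟩ := (Ideal.span_eq_top_iff_finite T).mp hT
  have hT'' : ∀ g : T', ∃ N : Submodule Γ(X, V) Γ(M, V), N.FG ∧
      ∀ m : Γ(M, V), ∃ n : ℕ, (g : Γ(X, V)) ^ n • m ∈ N := fun g => hT'T g.2
  choose N hNfg hN using hT''
  have hN₀ : (⨆ g, N g).FG := Submodule.fg_iSup N hNfg
  have htop : (⨆ g, N g) = ⊤ := by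
    refine eq_top_iff.mpr fun m _ => ?_
    refine Submodule.mem_of_span_eq_top_of_smul_pow_mem _ (T' : Set Γ(X, V)) hT' m fun g => ?_
    obtain ⟨n, hn⟩ := hN ⟨g, g.2⟩ m
    exact ⟨n, le_iSup N _ hn⟩
  exact ⟨by rw [← htop]; exact hN₀⟩

/-- **A vector bundle is coherent** in the affine-local sense `Coh` of the dévissage (Hartshorne II
Prop. 5.5 with Prop. 5.4): quasi-coherent (locally free) modules are affine-localizing
(`IsAffineLocalizing.of_isQuasicoherent`, II Lemma 5.3), and then of affine-finite type
(`isAffineFiniteType_of_isVectorBundle`). [cite: Hartshorne1977, II Prop. 5.4 and Prop. 5.5 (p. 113)] -/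
theorem coh_of_isVectorBundle {M : X.Modules} (hM : IsVectorBundle M) : Coh M := by
  haveI := hM.isLocallyFree
  have hloc : IsAffineLocalizing M := IsAffineLocalizing.of_isQuasicoherent M
  exact ⟨hloc, isAffineFiniteType_of_isVectorBundle hM hloc⟩

/-- Dot-notation form (deliberate extension of `Literature.AlgebraicGeometry.Motives.IsVectorBundle`
from the `Morphisms` directory). [cite: Hartshorne1977, II Prop. 5.5 (p. 113)] -/
theorem _root_.Literature.AlgebraicGeometry.Motives.IsVectorBundle.coh {M : X.Modules}
    (hM : IsVectorBundle M) : Coh M :=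
  coh_of_isVectorBundle hM

end Literature.AlgebraicGeometry.Morphisms

end
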